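import Summits.ValiantsHypothesis.ValiantsHypothesis.Theorems.KPlusLogSqLawOctaveTempered
import Summits.ValiantsHypothesis.ValiantsHypothesis.Theorems.KPlusLogSqLawTropicalBSignsFree

/-!
# Route «KPlusLogSqLaw», octave line — tempered representability: the conditioning statement that, with the PROVED `TemperedLifting`, gives Ω-W by name (a kernel-checked two-stub shape for the crux `OctaveWeakLifting`)

HONEST FRAMING.  Prover seat val-width-19561-oc1 (g3), `--supports stmt-ValiantsHypothesis-19561` (crux `WeakLifting`, OPEN), octave line of
val-idea-6.  `OctaveWeakLifting` (Ω-W, stmt-ValiantsHypothesis-24457 of the DRAFT sibling route KPlusLogSqLawOctave) is OPEN.  The statement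
`TemperedRepresentability` below is DEFINED, NOT asserted — it is the seat's typing of what the tempered-lifting METHOD still needs, offered to
the planners as a candidate ceiling-lift stub; nothing here claims it, no skeleton is registered by this seat, and VP ≠ VNP is not moved.

CONTENT (0 sorry).
* `TemperedRepresentability` (DEFINITION, NOT asserted): there is an absolute `C` such that the determinant of every real symmetric `(m, K)`
  pencil is, up to a nonzero constant, the determinant of a SAME-FORMAT real pencil (same exponents `d`, arbitrary real letters) that is
  root-tempered with temper `2^{C (K + ⌊log₂ m⌋²)}` (`RootTempered`, file `…OctaveTempered`: at every root scale the design envelope is within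
  that many bits of the true Newton top).  Conjugates `(G S_l H)_l` are such representations (`pencilDet_conj`), so are block re-factorings.
* `octaveWeakLifting_of_temperedRepresentability : TemperedRepresentability → OctaveWeakLifting` — KERNEL GLUE: the signed tropical row
  costs a factor two (`tropRowD_of_tropRootLawAt`, p-landed in `…TropicalBSignsFree`), `temperedLifting_proof` bounds the octaves of the tempered
  representation, `octaveCount_C_mul` transfers them, and `(2(2M + 2^{C(K+L)} + 1) + 3)(2n + 1) ≤ 2^{(C+10)(K+L)}(n + 1)` (`L = ⌊log₂ m⌋²`,
  `M = m(⌊log₂(mK)⌋+1)`; `temper_arith`).  So «`TemperedLifting` (PROVED) + `TemperedRepresentability` (OPEN) ⇒ Ω-W» is a two-stub composition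
  concluding the crux by name.
* WHY `TemperedRepresentability` MIGHT FAIL (honest): it asks for a representation whose raw Leibniz expansion never towers over the truth at a
  root scale by more than a doubly-exponential FACTOR `2^{2^{C(K+L)}}`.  Hidden moving-frame congruences defeat any FIXED basis: the `2 × 2` block
  `(I + x^a N)ᵀ S (I + x^a N) = S + x^a (NᵀS + SN) + x^{2a} NᵀSN` (`N² = 0`) has constant determinant `det S` but, in EVERY basis, a present dead
  class of exponent `2a` or `4a` (exponent RESONANCE `0 + 2a = a + a`, not orthogonality); glued block-diagonally to an honest root at scale `θ₀`
  it gives a symmetric `(3, 4)` family whose block-basis temper at its root is `≈ 2aθ₀ → ∞` while `Ω = 1`.  The cure there is a change of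
  REPRESENTATION (replace the dead block by `diag(det S, 1)`: same format, same determinant, tempered), which is why the statement quantifies over
  same-format representations and not over bases; whether every symmetric pencil admits such a representation is OPEN, and a pencil all of whose
  same-format representations carry a deep dead reign at a root scale would refute it (none is known to the seat; the masking search of g2 at
  `m = 2` found no deep pockets at all).
-/

set_option linter.dupNamespace false
set_option autoImplicit false

namespace Summit.ValiantsHypothesis.ValiantsHypothesis.Theorems.KPlusLogSqLaw.Octave

open Polynomial Finset
open scoped BigOperators
open Summit.ValiantsHypothesis.ValiantsHypothesis.Theorems.LacunarySymmetroidMatrixDescartes.TropicalCensus (TropRootLawAt)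

section Glue

variable {m K : ℕ}

/-- **tempered representability** (candidate ceiling-lift statement for the octave line; DEFINED, NOT asserted): an absolute `C` such that
every real symmetric `(m, K)` pencil determinant equals, up to a nonzero constant factor, the determinant of a same-format real pencil (same
exponents) that is `2^{C(K + ⌊log₂ m⌋²)}`-tempered at each of its root scales.  Why it might fail: see the module docstring (hidden
moving-frame congruences / exponent resonances must be removable by re-representation, uniformly). [definition of the seat] -/
def TemperedRepresentability : Prop :=
  ∃ C : ℕ, ∀ (m K : ℕ) (d : Fin K → ℕ) (S : Fin K → Matrix (Fin m) (Fin m) ℝ), (∀ l, (S l).IsSymm) →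
    ∃ (S' : Fin K → Matrix (Fin m) (Fin m) ℝ) (c : ℝ), c ≠ 0 ∧
      pencilDet d S' = Polynomial.C c * pencilDet d S ∧ RootTempered d S' (2 ^ (C * (K + Nat.log 2 m ^ 2)))

/-- conjugates are same-format representations: a root-tempered conjugate witnesses the representability clause. [folklore] -/
theorem exists_repr_of_rootTempered_conj (d : Fin K → ℕ) (S : Fin K → Matrix (Fin m) (Fin m) ℝ) (G H : Matrix (Fin m) (Fin m) ℝ)
    (hG : G.det ≠ 0) (hH : H.det ≠ 0) (W : ℕ) (hW : RootTempered d (fun l => G * S l * H) W) :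
    ∃ (S' : Fin K → Matrix (Fin m) (Fin m) ℝ) (c : ℝ), c ≠ 0 ∧ pencilDet d S' = Polynomial.C c * pencilDet d S ∧ RootTempered d S' W :=
  ⟨fun l => G * S l * H, G.det * H.det, mul_ne_zero hG hH, pencilDet_conj G H d S, hW⟩

/-- the empty pencil has no root octaves. [folklore] -/
theorem octaveCount_pencilDet_zero_letters (d : Fin 0 → ℕ) (S : Fin 0 → Matrix (Fin m) (Fin m) ℝ) :
    octaveCount (pencilDet d S) = 0 := by
  unfold pencilDet octaveCount
  have h0 : (∑ l : Fin 0, ((Polynomial.X : Polynomial ℝ) ^ d l) • (S l).map Polynomial.C) = 0 := by simp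
  rw [h0]
  rcases Nat.eq_zero_or_pos m with hm | hm
  · subst hm
    simp [Matrix.det_isEmpty]
  · haveI : Nonempty (Fin m) := ⟨⟨0, hm⟩⟩
    simp [Matrix.det_zero]

/-- the arithmetic of the glue: `(2(2M + 2^{C E} + 1) + 3)(2n + 1) ≤ 2^{(C+10) E}(n + 1)` with `E = K + ⌊log₂ m⌋² ≥ 1`,
`M = m(⌊log₂(mK)⌋ + 1)`. [folklore] -/
theorem temper_arith (C m K n : ℕ) (hK : 0 < K) :
    (2 * (2 * (m * (Nat.log 2 (m * K) + 1)) + 2 ^ (C * (K + Nat.log 2 m ^ 2)) + 1) + 3) * (2 * n + 1)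
      ≤ 2 ^ ((C + 10) * (K + Nat.log 2 m ^ 2)) * (n + 1) := by
  set L := Nat.log 2 m ^ 2 with hL
  set E := K + L with hE
  have hE1 : 1 ≤ E := by omega
  have hlogL : Nat.log 2 m ≤ L := by rw [hL]; exact Nat.le_self_pow two_ne_zero _
  -- m ≤ 2^E
  have hm : m ≤ 2 ^ E := by
    have h1 : m < 2 ^ (Nat.log 2 m + 1) := Nat.lt_pow_succ_log_self one_lt_two m
    have h2 : 2 ^ (Nat.log 2 m + 1) ≤ 2 ^ E := Nat.pow_le_pow_right two_pos (by omega)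
    omega
  -- K ≤ 2^E
  have hKE : K ≤ 2 ^ E := (Nat.lt_two_pow_self).le.trans (Nat.pow_le_pow_right two_pos (by omega))
  -- M ≤ 2^(3E+1)
  have hlog : Nat.log 2 (m * K) + 1 ≤ m * K + 1 := Nat.add_le_add_right (Nat.log_le_self 2 _) 1
  have hmK : m * K + 1 ≤ 2 ^ (2 * E + 1) := by
    have h1 : m * K ≤ 2 ^ E * 2 ^ E := Nat.mul_le_mul hm hKE
    have h2 : 2 ^ E * 2 ^ E = 2 ^ (2 * E) := by rw [← pow_add]; ring_nf
    have h3 : 1 ≤ 2 ^ (2 * E) := Nat.one_le_two_pow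
    have h4 : 2 ^ (2 * E + 1) = 2 * 2 ^ (2 * E) := by rw [pow_succ]; ring
    omega
  have hM : m * (Nat.log 2 (m * K) + 1) ≤ 2 ^ (3 * E + 1) := by
    calc m * (Nat.log 2 (m * K) + 1) ≤ 2 ^ E * 2 ^ (2 * E + 1) := Nat.mul_le_mul hm (hlog.trans hmK)
      _ = 2 ^ (3 * E + 1) := by rw [← pow_add]; ring_nf
  -- the three summands against 2^((C+10)E - 3)
  set T := (C + 10) * E with hT
  have hT7 : 3 * E + 4 + 3 ≤ T := by rw [hT]; nlinarith
  have hTC : C * E + 2 + 3 ≤ T := by rw [hT]; nlinarith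
  have hT4 : 4 + 3 ≤ T := by rw [hT]; nlinarith
  have hA : 2 ^ (3 * E + 4) ≤ 2 ^ (T - 3) := Nat.pow_le_pow_right two_pos (by omega)
  have hB : 2 ^ (C * E + 2) ≤ 2 ^ (T - 3) := Nat.pow_le_pow_right two_pos (by omega)
  have hC' : 2 ^ 4 ≤ 2 ^ (T - 3) := Nat.pow_le_pow_right two_pos (by omega)
  have hsum : 3 * 2 ^ (T - 3) ≤ 2 ^ T := by
    have : 2 ^ T = 2 ^ 3 * 2 ^ (T - 3) := by rw [← pow_add]; congr 1; omega
    rw [this]; omega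
  -- assemble
  have h34 : 2 ^ (3 * E + 4) = 8 * 2 ^ (3 * E + 1) := by
    rw [show 3 * E + 4 = (3 * E + 1) + 3 by ring, pow_add]; ring
  have hC2 : 2 ^ (C * E + 2) = 4 * 2 ^ (C * E) := by rw [pow_add]; ring
  have hCE : C * (K + Nat.log 2 m ^ 2) = C * E := by rw [hE, hL]
  rw [hCE]
  have hlhs : (2 * (2 * (m * (Nat.log 2 (m * K) + 1)) + 2 ^ (C * E) + 1) + 3) * (2 * n + 1)
      ≤ (2 ^ (3 * E + 4) + 2 ^ (C * E + 2) + 2 ^ 4) * (n + 1) := by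
    have h1 : (2 * (2 * (m * (Nat.log 2 (m * K) + 1)) + 2 ^ (C * E) + 1) + 3) * (2 * n + 1)
        ≤ (2 * (2 * (m * (Nat.log 2 (m * K) + 1)) + 2 ^ (C * E) + 1) + 3) * (2 * (n + 1)) :=
      Nat.mul_le_mul_left _ (by omega)
    rw [h34, hC2]
    nlinarith [hM, Nat.zero_le n, Nat.zero_le (2 ^ (C * E))]
  calc _ ≤ (2 ^ (3 * E + 4) + 2 ^ (C * E + 2) + 2 ^ 4) * (n + 1) := hlhs
    _ ≤ (3 * 2 ^ (T - 3)) * (n + 1) := Nat.mul_le_mul_right _ (by omega)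
    _ ≤ 2 ^ T * (n + 1) := Nat.mul_le_mul_right _ hsum

/-- **KERNEL GLUE: tempered representability ⇒ Ω-W.**  Given the signed tropical row `≤ n` of format `(m, K)` (the verbatim hypothesis of
`OctaveWeakLifting` = `TropRootLawAt m K n`), the unsigned row is `≤ 2n` (`tropRowD_of_tropRootLawAt`); the tempered representation `S'` of
`det` has `Ω ≤ (2(2M + W + 1) + 3)(2n + 1)` by `temperedLifting_proof`, the same octaves as `det` itself (`octaveCount_C_mul`), and the
arithmetic `temper_arith` closes with `C ↦ C + 10`.  Together with the PROVED `TemperedLifting` this is a two-stub composition concluding the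
crux `OctaveWeakLifting` by name; the open stub is `TemperedRepresentability` (NOT asserted). [folklore] -/
theorem octaveWeakLifting_of_temperedRepresentability (h : TemperedRepresentability) : OctaveWeakLifting := by
  obtain ⟨C, hC⟩ := h
  refine ⟨C + 10, fun m K n hT => ?_⟩
  intro d S hS
  change octaveCount (pencilDet d S) ≤ _
  rcases Nat.eq_zero_or_pos K with hK | hK
  · subst hK
    rw [octaveCount_pencilDet_zero_letters]
    exact Nat.zero_le _
  · have hT' : TropRootLawAt m K n := fun d v ε n' θ p hε hθ hdom halt => hT d v ε n' θ p hε hθ hdom halt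
    have hTD : Summit.ValiantsHypothesis.ValiantsHypothesis.Theorems.KPlusLogSqLaw.TropRowD m K (2 * n) :=
      Summit.ValiantsHypothesis.ValiantsHypothesis.Theorems.KPlusLogSqLaw.tropRowD_of_tropRootLawAt hT'
    obtain ⟨S', c, hc, heq, hW⟩ := hC m K d S hS
    have hΩ : octaveCount (pencilDet d S) = octaveCount (pencilDet d S') := by
      rw [heq, octaveCount_C_mul c hc]
    rw [hΩ]
    exact (temperedLifting_proof m K (2 * n) _ hTD d S' hW).trans (temper_arith C m K n hK)

end Glue

/-! ### Free exponents (appended, same seat): the representing pencil may use any exponent vector of the same length -/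

section FreeExponents

variable {m K : ℕ}

/-- **free-exponent tempered representability** (weaker candidate; DEFINED, NOT asserted): as `TemperedRepresentability`, but the representing
pencil may use ANY exponent vector `d' : Fin K → ℕ` of the same length and any real letters — the tropical hypothesis `TropRowD m K n` of the
lifting covers every exponent vector of the format, so nothing is lost in the glue.  This admits, e.g., completing squares / undoing moving
frames whose shifted exponents are not among the original `d`.  Why it might fail: as for `TemperedRepresentability` (a symmetric pencil all of
whose `(m, K)` determinantal representations carry a deep dead reign at one of its root scales), now over a larger search space. [definition of the seat] -/
def FreeTemperedRepresentability : Prop :=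
  ∃ C : ℕ, ∀ (m K : ℕ) (d : Fin K → ℕ) (S : Fin K → Matrix (Fin m) (Fin m) ℝ), (∀ l, (S l).IsSymm) →
    ∃ (d' : Fin K → ℕ) (S' : Fin K → Matrix (Fin m) (Fin m) ℝ) (c : ℝ), c ≠ 0 ∧
      pencilDet d' S' = Polynomial.C c * pencilDet d S ∧ RootTempered d' S' (2 ^ (C * (K + Nat.log 2 m ^ 2)))

/-- the same-exponent candidate implies the free-exponent one. [folklore] -/
theorem freeTemperedRepresentability_of_temperedRepresentability (h : TemperedRepresentability) : FreeTemperedRepresentability := by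
  obtain ⟨C, hC⟩ := h
  refine ⟨C, fun m K d S hS => ?_⟩
  obtain ⟨S', c, hc, heq, hW⟩ := hC m K d S hS
  exact ⟨d, S', c, hc, heq, hW⟩

/-- **KERNEL GLUE (free exponents): `FreeTemperedRepresentability → OctaveWeakLifting`** — same composition as
`octaveWeakLifting_of_temperedRepresentability`, the tempered lifting being applied to the representing pencil `(d', S')` of the same format.
[folklore] -/
theorem octaveWeakLifting_of_freeTemperedRepresentability (h : FreeTemperedRepresentability) : OctaveWeakLifting := by
  obtain ⟨C, hC⟩ := h
  refine ⟨C + 10, fun m K n hT => ?_⟩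
  intro d S hS
  change octaveCount (pencilDet d S) ≤ _
  rcases Nat.eq_zero_or_pos K with hK | hK
  · subst hK
    rw [octaveCount_pencilDet_zero_letters]
    exact Nat.zero_le _
  · have hT' : TropRootLawAt m K n := fun d v ε n' θ p hε hθ hdom halt => hT d v ε n' θ p hε hθ hdom halt
    have hTD : Summit.ValiantsHypothesis.ValiantsHypothesis.Theorems.KPlusLogSqLaw.TropRowD m K (2 * n) :=
      Summit.ValiantsHypothesis.ValiantsHypothesis.Theorems.KPlusLogSqLaw.tropRowD_of_tropRootLawAt hT'
    obtain ⟨d', S', c, hc, heq, hW⟩ := hC m K d S hS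
    have hΩ : octaveCount (pencilDet d S) = octaveCount (pencilDet d' S') := by
      rw [heq, octaveCount_C_mul c hc]
    rw [hΩ]
    exact (temperedLifting_proof m K (2 * n) _ hTD d' S' hW).trans (temper_arith C m K n hK)

end FreeExponents


end Summit.ValiantsHypothesis.ValiantsHypothesis.Theorems.KPlusLogSqLaw.Octave
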